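import Summits.BirchSwinnertonDyer.Rank1Residual.Supersingular.SharpFlatNonvanishing
import Literature.NumberTheory.EllipticCurves.ModularCurvePeriodRatio
import Literature.NumberTheory.EllipticCurves.ModularFormsGamma0Genus
import Literature.NumberTheory.EllipticCurves.PlusMinusPAdicLFunction
import Literature.NumberTheory.EllipticCurves.IwasawaAlgebra
import Mathlib.RingTheory.PowerSeries.NoZeroDivisors
import Mathlib.RingTheory.Ideal.Height
import HarnessLib

/-!
# Crux K1 `SprungLowerDivisibilityAtThree` (item stmt-BirchSwinnertonDyer-19875), line `chromatic-common-zeros`: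
# the ANALYTIC-RANK-ZERO facts the composition consumes — S0 at `r_an = 0` in the stub's binder shape, and
# «`(T)` is never a common zero at `r_an = 0`» (a cyclotomic common zero then lies over a non-trivial level)

Route `SignedLowerHalves` (crux #3) / `PrintX8VS` (crux #1); line card
`Cruxes/SprungLowerDivisibilityAtThree/Lines/chromatic-common-zeros.md`, skeleton `Lines/chromatic_common_zeros.lean`
(stubs S0 `stub_bothColours`, S4 `stub_cyclotomicLower`). `--supports` helper (width seat w3 under the 19875 lead):
closes NO item; K1 and BSD are NOT proved by anything here.

## Contents

* §1 `stub_bothColours_of_analyticRank_eq_zero` — stub S0 («both colours `L♯, L♭` of an X8 pair are non-zero»)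
  with its binder telescope VERBATIM and ONE extra binder `W.analyticRank = 0`: the tree theorem
  `Supersingular.ClassX8.sharp_ne_zero_and_flat_ne_zero_of_analyticRank_eq_zero` (Sprung 2012 Prop. 6.14 second
  sentence: constant terms `c_• · L(E,1)/Ω⁺_f`, `c_♯, c_♭ ≠ 0` at `p = 3 ∣ a₃`). S0 at `r_an ≥ 1` (Sprung 2017
  Conj. 4.12 on X8) stays OPEN.
* §2 `constantCoeff_ne_zero_of_normalised_of_analyticRank_eq_zero` / `normalised_notMem_of_X_mem` — at `r_an = 0`
  every Néron-normalised `G` (`ι G = C(ϖ)·ι L^•`) has `G(0) ≠ 0`, so `G` lies in no height-one prime containing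
  `T` (such a prime is `(T)`, `PowerSeries.X_prime` + `Ideal.eq_span_singleton_of_height_eq_one`).
* §3 `exists_cyclotomic_comp_mem_of_omega_mem` (algebra: `ω_n = T·ω_n⁺·ω_n⁻ ∈ 𝔭` prime, `T ∉ 𝔭` ⟹ some
  `Φ_{p^j}(1+T) ∈ 𝔭`, `1 ≤ j ≤ n`) and `cyclotomicCommonZero_level_pos_of_analyticRank_eq_zero` — in stub S4's
  hypothesis shape at `r_an = 0`: a height-one prime containing some `ω_n` and every normalised `G^{•'}` of every
  colour does NOT contain `T` and DOES contain `Φ_{3^j}(1+T)` for some `j ≥ 1`; i.e. S4's rank-zero residual sits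
  over the non-trivial characters of `3`-power conductor only (where both colours vanishing at `ζ_{3^j} − 1` is a
  vanishing twisted value `L(E, χ, 1) = 0`, Rohrlich-rare and decidable per pair).

References: [Sprung2012] Prop. 6.14 (p. 1498); [Sprung2017] Cor. 4.11 (table of special values), Conj. 4.12;
[Pollack2003] §6.5 (display before Prop. 6.18), Thm. 6.17; [Washington1997] §13.2.
-/

set_option autoImplicit false
-- justification: the mandated namespace `Summit.BirchSwinnertonDyer.BirchSwinnertonDyer.Theorems`
-- (single-conjunct summit, Sub = Summit) repeats a segment by design (D-0017).
set_option linter.dupNamespace false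

noncomputable section

open scoped Classical MatrixGroups ModularForm Polynomial

open CongruenceSubgroup WeierstrassCurve
  Literature.NumberTheory.EllipticCurves Literature.NumberTheory.EllipticCurves.ModularForms
  Literature.NumberTheory.EllipticCurves.Sprung2017
  Literature.NumberTheory.EllipticCurves.Rank1Residual
  Summit.BirchSwinnertonDyer.Rank1Residual.Supersingular

namespace Summit.BirchSwinnertonDyer.BirchSwinnertonDyer.Theorems.ChromaticCommonZerosRankZero

/-! ### §1 Stub S0 at analytic rank zero -/

/-- **Stub S0 `stub_bothColours` of line `chromatic-common-zeros` AT ANALYTIC RANK ZERO** (binder telescope of the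
registered stub verbatim, plus `W.analyticRank = 0`): on an X8 pair with `r_an(E) = 0`, for a newform `f` of `W`
and ANY Sprung pair `(L♯, L♭)`, both `L♯ ≠ 0` and `L♭ ≠ 0` — Sprung 2012 Prop. 6.14 (constant terms
`c_• · L(E,1)/Ω⁺_f ≠ 0`), tree theorem `ClassX8.sharp_ne_zero_and_flat_ne_zero_of_analyticRank_eq_zero`. The stub
itself (all ranks = Sprung 2017 [C] 4.12 on X8) is NOT proved here. [cite: Sprung2012, Prop. 6.14 (p. 1498)]
[cite: Sprung2017, Cor. 4.11 (table of special values)] -/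
theorem stub_bothColours_of_analyticRank_eq_zero :
    ∀ (W : WeierstrassCurve ℚ) [W.IsElliptic] [W.IsGloballyMinimal] (p : ℕ) [Fact p.Prime],
      ClassX8 W p → W.analyticRank = 0 → ∀ (N : ℕ) (_ : NeZero N) (f : CuspForm (Gamma0 N) 2)
        (Lsharp Lflat : IwasawaAlgebra p),
      IsNewformOf W f → IsSprungPair f p (W.frobeniusTrace p) Lsharp Lflat →
      Lsharp ≠ 0 ∧ Lflat ≠ 0 := by
  intro W _ _ p _ hX h0 N hN f Lsharp Lflat hf hSP
  exact ClassX8.sharp_ne_zero_and_flat_ne_zero_of_analyticRank_eq_zero W p hX hf hSP h0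

/-! ### §2 At analytic rank zero no normalised `G^•` lies in `(T)` -/

/-- **At `r_an = 0` every Néron-normalised chromatic function has non-zero constant term**: on an X8 pair with
`W.analyticRank = 0`, for `G ∈ Λ` with `ι G = C(ϖ) · ι L^•` one has `G(0) ≠ 0`, because
`L^•(0) = c_• · [0]⁺_f` (`constantCoeff_chromaticL_of_isSprungPair_of_isNewformOf`) with `c_• ≠ 0`
(`chromaticConst_ne_zero_of_dvd`, `3 ∣ a₃`), `[0]⁺_f ≠ 0` at `r_an = 0`
(`ratPlusSymbol_zero_ne_zero_of_analyticRank_eq_zero`) and `ϖ ≠ 0` (`Ω⁺_f > 0`).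
[cite: Sprung2012, Prop. 6.14 (p. 1498)] [cite: Sprung2017, Cor. 4.11 (table of special values)] -/
theorem constantCoeff_ne_zero_of_normalised_of_analyticRank_eq_zero
    (W : WeierstrassCurve ℚ) [W.IsElliptic] [W.IsGloballyMinimal] (p : ℕ) [Fact p.Prime]
    (hX : ClassX8 W p) (h0 : W.analyticRank = 0) {N : ℕ} [NeZero N] {f : CuspForm (Gamma0 N) 2}
    {ϖ : ℚ} {Lsharp Lflat : IwasawaAlgebra p} (hf : IsNewformOf W f)
    (hϖ : (ϖ : ℝ) * W.realPeriodRat = plusPeriod f)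
    (hSP : IsSprungPair f p (W.frobeniusTrace p) Lsharp Lflat) (col : Chroma) {G : IwasawaAlgebra p}
    (hG : iwasawaToPowerSeries p G =
      PowerSeries.C (ϖ : ℚ_[p]) * iwasawaToPowerSeries p (chromaticL col Lsharp Lflat)) :
    PowerSeries.constantCoeff G ≠ 0 := by
  have hp3 : p = 3 := hX.1
  subst hp3
  have hp2 : (3 : ℕ) ≠ 2 := by decide
  have hgood : W.HasGoodReductionAtPrime 3 := hX.2.1.1
  have hss : ((3 : ℕ) : ℤ) ∣ W.frobeniusTrace 3 := hX.2.1.2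
  have hLε := constantCoeff_chromaticL_of_isSprungPair_of_isNewformOf hp2 hf hgood hSP col
  have hc : (chromaticConst 3 (W.frobeniusTrace 3) col : ℚ_[3]) ≠ 0 := by
    exact_mod_cast chromaticConst_ne_zero_of_dvd 3 hp2 hss col
  have hr : ((ratPlusSymbol f 0 : ℚ) : ℚ_[3]) ≠ 0 := by
    exact_mod_cast ratPlusSymbol_zero_ne_zero_of_analyticRank_eq_zero hf h0
  -- `ϖ ≠ 0` since `Ω⁺_f > 0` (same two lines as `Theorems.SignedKatoOffTwo.varpi_ne_zero`, whose module sits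
  -- inside a Theses cone and is therefore not imported here)
  have hϖne : ϖ ≠ 0 := by
    rintro rfl
    rw [Rat.cast_zero, zero_mul] at hϖ
    exact (IsNewform0.plusPeriod_pos_holds hf.1 hf.coeffField_eq_bot).ne hϖ
  have hϖ0 : ((ϖ : ℚ) : ℚ_[3]) ≠ 0 := by exact_mod_cast hϖne
  -- constant terms of both sides of `hG`
  have hcoeff := congrArg PowerSeries.constantCoeff hG
  rw [map_mul, PowerSeries.constantCoeff_C] at hcoeff
  intro hG0
  have h1 : PowerSeries.constantCoeff (iwasawaToPowerSeries 3 G) = 0 := by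
    rw [← PowerSeries.coeff_zero_eq_constantCoeff_apply, PowerSeries.coeff_map,
      PowerSeries.coeff_zero_eq_constantCoeff_apply, hG0, map_zero]
  have h2 : PowerSeries.constantCoeff (iwasawaToPowerSeries 3 (chromaticL col Lsharp Lflat)) =
      ((PowerSeries.constantCoeff (chromaticL col Lsharp Lflat) : ℤ_[3]) : ℚ_[3]) := by
    rw [← PowerSeries.coeff_zero_eq_constantCoeff_apply, PowerSeries.coeff_map,
      PowerSeries.coeff_zero_eq_constantCoeff_apply]
    rfl
  rw [h1, h2, hLε] at hcoeff
  exact mul_ne_zero hϖ0 (mul_ne_zero hc hr) hcoeff.symm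

/-- **Hence at `r_an = 0` no normalised `G^•` lies in a height-one prime containing `T`** (that prime is `(T)`:
`T` is a prime element of `Λ`, `PowerSeries.X_prime`; and `G ∈ (T) ⟺ G(0) = 0`). In particular `(T)` is never a
common zero of `(ϖL♯, ϖL♭)` at analytic rank zero. [cite: Sprung2012, Prop. 6.14 (p. 1498)]
[cite: Washington1997, §13.2] -/
theorem normalised_notMem_of_X_mem
    (W : WeierstrassCurve ℚ) [W.IsElliptic] [W.IsGloballyMinimal] (p : ℕ) [Fact p.Prime]
    (hX : ClassX8 W p) (h0 : W.analyticRank = 0) {N : ℕ} [NeZero N] {f : CuspForm (Gamma0 N) 2}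
    {ϖ : ℚ} {Lsharp Lflat : IwasawaAlgebra p} (hf : IsNewformOf W f)
    (hϖ : (ϖ : ℝ) * W.realPeriodRat = plusPeriod f)
    (hSP : IsSprungPair f p (W.frobeniusTrace p) Lsharp Lflat) (col : Chroma) {G : IwasawaAlgebra p}
    (hG : iwasawaToPowerSeries p G =
      PowerSeries.C (ϖ : ℚ_[p]) * iwasawaToPowerSeries p (chromaticL col Lsharp Lflat))
    (𝔭 : PrimeSpectrum (IwasawaAlgebra p)) (h𝔭 : 𝔭.asIdeal.height = 1)
    (hT : (PowerSeries.X : IwasawaAlgebra p) ∈ 𝔭.asIdeal) : G ∉ 𝔭.asIdeal := by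
  rw [Ideal.eq_span_singleton_of_height_eq_one h𝔭 hT PowerSeries.X_prime, Ideal.mem_span_singleton,
    PowerSeries.X_dvd_iff]
  exact constantCoeff_ne_zero_of_normalised_of_analyticRank_eq_zero W p hX h0 hf hϖ hSP col hG

/-! ### §3 A cyclotomic common zero at analytic rank zero lies over a non-trivial level -/

/-- **Algebra**: if a prime ideal `𝔭` of `Λ = ℤ_p⟦T⟧` contains `ω_n = (1+T)^{pⁿ} − 1` but not `T`, then it contains
`Φ_{p^j}(1+T)` for some `1 ≤ j ≤ n` — from `ω_n = T · ω_n⁺ · ω_n⁻` (`X_mul_cyclotomicOmegaPlus_mul_cyclotomicOmegaMinus`)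
and the product formulas for `ω_n^±`. [cite: Pollack2003, §6.5 (display before Prop. 6.18)] -/
theorem exists_cyclotomic_comp_mem_of_omega_mem (p : ℕ) [Fact p.Prime]
    (𝔭 : PrimeSpectrum (IwasawaAlgebra p)) (n : ℕ)
    (hω : (((cyclotomicOmega p n).map (Int.castRingHom ℤ_[p]) : ℤ_[p][X]) : PowerSeries ℤ_[p]) ∈ 𝔭.asIdeal)
    (hT : (PowerSeries.X : IwasawaAlgebra p) ∉ 𝔭.asIdeal) :
    ∃ j : ℕ, 1 ≤ j ∧ j ≤ n ∧
      ((((Polynomial.cyclotomic (p ^ j) ℤ).comp (Polynomial.X + 1)).map (Int.castRingHom ℤ_[p]) : ℤ_[p][X]) :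
        PowerSeries ℤ_[p]) ∈ 𝔭.asIdeal := by
  -- the ring hom `ℤ[X] → Λ`
  set φ : ℤ[X] →+* PowerSeries ℤ_[p] :=
    (Polynomial.coeToPowerSeries.ringHom (R := ℤ_[p])).comp (Polynomial.mapRingHom (Int.castRingHom ℤ_[p]))
    with hφ_def
  have hφ : ∀ q : ℤ[X], φ q = ((q.map (Int.castRingHom ℤ_[p]) : ℤ_[p][X]) : PowerSeries ℤ_[p]) :=
    fun q => rfl
  have hωφ : φ (cyclotomicOmega p n) ∈ 𝔭.asIdeal := by rw [hφ]; exact hω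
  rw [← X_mul_cyclotomicOmegaPlus_mul_cyclotomicOmegaMinus, map_mul, map_mul] at hωφ
  have hXφ : φ Polynomial.X = (PowerSeries.X : IwasawaAlgebra p) := by
    rw [hφ, Polynomial.map_X, Polynomial.coe_X]
  rcases 𝔭.isPrime.mem_or_mem hωφ with h | h
  · rcases 𝔭.isPrime.mem_or_mem h with h | h
    · exact absurd (hXφ ▸ h) hT
    · -- a factor of `ω_n⁺`
      rw [cyclotomicOmegaPlus, map_prod] at h
      obtain ⟨k, hk, hmem⟩ := (𝔭.isPrime.prod_mem_iff (s := Finset.Icc 1 (n / 2))).mp h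
      rw [Finset.mem_Icc] at hk
      refine ⟨2 * k, by omega, by omega, ?_⟩
      rw [← hφ]; exact hmem
  · -- a factor of `ω_n⁻`
    rw [cyclotomicOmegaMinus, map_prod] at h
    obtain ⟨k, hk, hmem⟩ := (𝔭.isPrime.prod_mem_iff (s := Finset.Icc 1 ((n + 1) / 2))).mp h
    rw [Finset.mem_Icc] at hk
    refine ⟨2 * k - 1, by omega, by omega, ?_⟩
    rw [← hφ]; exact hmem

/-- **Stub S4's residual at analytic rank zero lies over the NON-TRIVIAL characters only.** In the hypothesis shape
of `stub_cyclotomicLower` (a height-one prime `𝔭` of `Λ = ℤ₃⟦T⟧` containing some `ω_n` — «cyclotomic» — and a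
Néron-normalised `G` of SOME colour — in particular every «common zero»), on an X8 pair with `W.analyticRank = 0`:
`T ∉ 𝔭`, and `Φ_{3^j}(1+T) ∈ 𝔭` for some `1 ≤ j ≤ n`. (At `r_an = 0` both `L♯(0), L♭(0)` are non-zero multiples of
`L(E,1)/Ω⁺_f`; so the Eisenstein inequality at cyclotomic common zeros is only ever needed at the primes
`(Φ_{3^j}(1+T))`, `j ≥ 1`, where a common zero means a vanishing twisted value — Rohrlich-rare, decidable per pair.)
[cite: Sprung2012, Prop. 6.14 (p. 1498)] [cite: Pollack2003, §6.5 (display before Prop. 6.18) and Thm. 6.17] -/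
theorem cyclotomicCommonZero_level_pos_of_analyticRank_eq_zero
    (W : WeierstrassCurve ℚ) [W.IsElliptic] [W.IsGloballyMinimal] (p : ℕ) [Fact p.Prime]
    (hX : ClassX8 W p) (h0 : W.analyticRank = 0) {N : ℕ} [NeZero N] {f : CuspForm (Gamma0 N) 2}
    {ϖ : ℚ} {Lsharp Lflat : IwasawaAlgebra p} (hf : IsNewformOf W f)
    (hϖ : (ϖ : ℝ) * W.realPeriodRat = plusPeriod f)
    (hSP : IsSprungPair f p (W.frobeniusTrace p) Lsharp Lflat) (col : Chroma) {G : IwasawaAlgebra p}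
    (hG : iwasawaToPowerSeries p G =
      PowerSeries.C (ϖ : ℚ_[p]) * iwasawaToPowerSeries p (chromaticL col Lsharp Lflat))
    (𝔭 : PrimeSpectrum (IwasawaAlgebra p)) (h𝔭 : 𝔭.asIdeal.height = 1)
    (hcyc : ∃ n : ℕ, ((cyclotomicOmega p n).map (Int.castRingHom ℤ_[p]) : PowerSeries ℤ_[p]) ∈ 𝔭.asIdeal)
    (hG𝔭 : G ∈ 𝔭.asIdeal) :
    (PowerSeries.X : IwasawaAlgebra p) ∉ 𝔭.asIdeal ∧
      ∃ n j : ℕ, 1 ≤ j ∧ j ≤ n ∧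
        ((cyclotomicOmega p n).map (Int.castRingHom ℤ_[p]) : PowerSeries ℤ_[p]) ∈ 𝔭.asIdeal ∧
        ((((Polynomial.cyclotomic (p ^ j) ℤ).comp (Polynomial.X + 1)).map (Int.castRingHom ℤ_[p]) : ℤ_[p][X]) :
          PowerSeries ℤ_[p]) ∈ 𝔭.asIdeal := by
  have hT : (PowerSeries.X : IwasawaAlgebra p) ∉ 𝔭.asIdeal := fun hT =>
    normalised_notMem_of_X_mem W p hX h0 hf hϖ hSP col hG 𝔭 h𝔭 hT hG𝔭
  obtain ⟨n, hn⟩ := hcyc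
  obtain ⟨j, hj1, hjn, hmem⟩ := exists_cyclotomic_comp_mem_of_omega_mem p 𝔭 n hn hT
  exact ⟨hT, n, j, hj1, hjn, hn, hmem⟩

end Summit.BirchSwinnertonDyer.BirchSwinnertonDyer.Theorems.ChromaticCommonZerosRankZero

end
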